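import Summits.MatrixMultiplication.MatrixMultiplication.Theses.FidelityWitnesses
import Literature.Computability.AlgebraicComplexity.BorderRankMatMulTwoApolarity
import Literature.Computability.AlgebraicComplexity.BorderApolarityGeneric

/-!
# Line `quantitative-apolarity` for crux `FidelityWitnesses.FidelityGapTwoSix` (stmt-MatrixMultiplication-4957)

Skeleton (crux-plan, planner-cruxplan-stmt-MatrixMultiplication-4957-quantitative-apolari-0, 2026-08-16) of
idea card `Cruxes/FidelityGapTwoSix/Ideas/quantitative-apolarity.md` (crux-ideate r1, ideator 1; triage r1-1:
**pass**, sharpenings (1)–(4) built in, see the line card `Lines/quantitative-apolarity.md`).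

THE CRUX. `FidelityGapTwoSix : ∃ ε > 0, ∀ S : P2 → P2 → P2 → ℂ, tensorRank S ≤ 6 →
‖∑ S·⟨2,2,2⟩‖² ≤ (1 − ε) · 8 · ∑ ‖S‖²` (`P2 = Fin 2 × Fin 2`; slots of a tensor `t c a b`: `c` = the
`C`/output slot, `(a, b)` = the `A × B` slots carrying the bilinear forms, exactly as in the tree's
`annSub`, `MatMulTwo.mul210`, `MatMulTwo.mul120`).

THE LINE (robust weak border apolarity). Write `W_T := annSub ⟨2,2,2⟩ ⊂ ℂ^{P2 × P2}` (the `12`-plane of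
bilinear forms annihilating the four slices of `T = ⟨2,2,2⟩`; its orthogonal complement is spanned by
the four slices, pairwise orthogonal of norm `√2`). An ANNIHILATING `10`-FRAME of a tensor `S` is an
orthonormal family `Y₀,…,Y₉ ∈ annSub S` (`IsAnnFrame`); its `(210)`/`(120)` MULTIPLICATION MAPS
`M210Lin Y, M120Lin Y : ℂ^{10 × 4} → ℂ^{P2 × P2 × P2}`, `v ↦ ∑_{r,a₀} v(r,a₀) · (Y_r · e_{a₀})`, have as
ranges the product spaces `E·A*`, `E·B*` of `E = span Y` (CHL 2023 §3 tests, tree coordinates).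
* `stub_annFrame_of_rank_le_six` (K-input, weak border apolarity for HONEST rank `≤ 6`, frame form): every
  `S` of rank `≤ 6` has an annihilating `10`-frame whose two multiplication maps have rank `≤ 34 = 40 − 6`
  — the tree's `TensorApolarity.exists_subspace_of_algBorderRank_le` / first half of
  `MatMulTwo.seven_le_algBorderRank_matMulTensor_two` (WITH the generic perturbation step: honest
  decompositions may be degenerate — triage sharpening (1)), plus a `10`-dimensional subspace and
  Gram–Schmidt in coordinates.
* `stub_frameGapCertificate` (THE LEVER, hardest): a uniform singular-value gap `φ₀ > 0` — at every
  annihilating `10`-frame `Y` of `⟨2,2,2⟩` ITSELF, `σ₃₅(M210Lin Y) ≥ φ₀` or `σ₃₅(M120Lin Y) ≥ φ₀`, stated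
  in Courant–Fischer form (every `6`-dimensional subspace of the `40`-dimensional domain contains a vector
  stretched by `≥ φ₀`). Qualitative skeleton (`φ₀`-free: rank `≥ 35` for one test) = second half of the
  tree proof of `7 ≤ R̲(⟨2,2,2⟩)` (torus degeneration + `MatMulTwo.rank_test_ge`), re-proved in frame form
  by triage r1-1 (`frame_fails_a_test`, Q.lean on the item); `∃ φ₀` then follows by compactness of the
  Stiefel manifold, and an EXPLICIT rational `φ₀` (target: any rational below the certified landscape
  minimum, numerically `≈ 0.27`; SOS/Putinar on `St(2, ℂ¹²)` or Nullstellensatz cofactors over `ℚ`) is the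
  content the route wants — triage sharpening (4): the value is NOT fixed in the statement.
* `stub_annihilator_defect` (metric transfer, part 1): if `S` beats fidelity `1 − η` against `T`, every
  `φ ∈ annSub S` is `√(8η)‖φ‖`-close to `W_T` in the sense `∑_c |∑_{ab} φ(a,b) T(c,a,b)|² ≤ 8η‖φ‖²`
  (decompose `T = αS + T⊥` with `‖T⊥‖² = 8(1 − fid) < 8η`; the pairing kills `S`; Cauchy–Schwarz slice by
  slice). No rephasing, no Wedin.
* `stub_kernel_transfer` (metric transfer, part 2): an orthonormal `10`-frame `Y` that is `θ`-close to
  `W_T` (`θ ≤ 1/8`) with both multiplication ranks `≤ 34` yields an annihilating `10`-frame `Y'` of `T`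
  (orthonormal basis of the projection of `span Y` to `W_T`) and `6`-dimensional subspaces `V₁, V₂` of the
  domain on which `‖M210Lin Y' v‖² ≤ 4θ‖v‖²`, `‖M120Lin Y' v‖² ≤ 4θ‖v‖²` (transport the `≥ 6`-dimensional
  kernels of `M_Y` through the change of basis `R`, `σ_min(R) ≥ 1 − √(θ/2) ≥ 3/4`; `M_{Y'}(Rᵀv) = −M_{Y−PY} v`
  on `ker M_Y`, `‖M_Z v‖ ≤ 2‖Z‖_F ‖v‖`).
* `FidelityGapTwoSix_of` — the kernel-checked composition: `ε := min (1/640) (φ₀²/640)`; a rank-`≤ 6`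
  violator `S` gives (stub A) a frame `Y`, (stub C1 row by row) `θ = 80ε ≤ 1/8`, (stub C2) a frame `Y'` of
  `T` with `6`-planes `V₁, V₂` of `320ε`-small vectors, and the certificate at `Y'` produces `v ≠ 0` in
  `V₁` or `V₂` with `φ₀²‖v‖² ≤ 320ε‖v‖² ≤ φ₀²‖v‖²/2` — absurd.

Disproof.lean: NONE exists for this crux at planning time (payload `disproof_path` absent on the hub,
`ledger crux ls stmt-MatrixMultiplication-4957` lists only `Ideas/*` and `TRIAGE-r1-1.md`), so no
`_false_without_` obstruction is on record and no `Theorems/FidelityGapTwoSix/Negative/*` lemma has landed.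
Self-imposed obstruction checks (card § Disproof used): (H₁ = rank ≤ 6) is used exactly in
`stub_annFrame_of_rank_le_six` — `6` points impose `≤ 6` conditions, `dim ≥ 16 − 6 = 10`; with `7` points
only `9`-frames survive and Strassen's seven triads give a PASSING `9`-frame, so no `9`-frame analogue of the
certificate is claimed; (H₂) the `ε` produced is `≤ 1/640 < 1/8`, the ceiling forced by the honest rank-`6`
tensor `⟨2,2,2⟩ −` (one standard triad) of fidelity `7/8` (item evidence Evidence-4957.md); (H₃) the
`φ₀`-free skeleton of the certificate is a tree theorem, so no refuted strengthening is assumed.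
Negatives index (`ledger negatives --problem MatrixMultiplication`: STPP designs / design flattening /
Fourier two families) — unrelated statements; no stub is an instance of one.
-/

noncomputable section

namespace Summit.MatrixMultiplication.MatrixMultiplication.Cruxes.FidelityGapTwoSix.QuantitativeApolarity

open scoped BigOperators ComplexConjugate
open Literature.Computability.AlgebraicComplexity
open Summit.MatrixMultiplication.MatrixMultiplication.Theses.FidelityWitnesses

set_option linter.unusedVariables false
set_option linter.dupNamespace false

/-! ## Vocabulary -/

/-- A slot of `⟨2,2,2⟩`: index pairs (the tree's `MatMulTwo.P2`). -/
abbrev P2 : Type := Fin 2 × Fin 2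

/-- The `(210)` multiplication map of a `10`-frame `Y` of bilinear forms on `A × B`:
`v ↦ ∑_{r, a₀} v(r, a₀) · (Y_r · e_{a₀}) ∈ S²A* ⊗ B*` in the tree's ordered coordinates
(`MatMulTwo.mul210`); its range is the product space `(span Y) · A*` of the `(210)` test. -/
def M210Lin (Y : Fin 10 → (P2 × P2 → ℂ)) : (Fin 10 × P2 → ℂ) →ₗ[ℂ] (P2 × P2 × P2 → ℂ) :=
  ∑ x : Fin 10 × P2, (LinearMap.proj x : (Fin 10 × P2 → ℂ) →ₗ[ℂ] ℂ).smulRight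
    (MatMulTwo.mul210 ℂ x.2 (Y x.1))

/-- The `(120)` multiplication map of a `10`-frame: `v ↦ ∑_{r, b₀} v(r, b₀) · (Y_r · e_{b₀}) ∈ A* ⊗ S²B*`
(`MatMulTwo.mul120`); its range is `(span Y) · B*`. -/
def M120Lin (Y : Fin 10 → (P2 × P2 → ℂ)) : (Fin 10 × P2 → ℂ) →ₗ[ℂ] (P2 × P2 × P2 → ℂ) :=
  ∑ x : Fin 10 × P2, (LinearMap.proj x : (Fin 10 × P2 → ℂ) →ₗ[ℂ] ℂ).smulRight
    (MatMulTwo.mul120 ℂ x.2 (Y x.1))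

/-- Unfolding lemma. -/
theorem M210Lin_apply (Y : Fin 10 → (P2 × P2 → ℂ)) (v : Fin 10 × P2 → ℂ) :
    M210Lin Y v = ∑ x : Fin 10 × P2, v x • MatMulTwo.mul210 ℂ x.2 (Y x.1) := by
  simp [M210Lin, LinearMap.sum_apply]

/-- Unfolding lemma. -/
theorem M120Lin_apply (Y : Fin 10 → (P2 × P2 → ℂ)) (v : Fin 10 × P2 → ℂ) :
    M120Lin Y v = ∑ x : Fin 10 × P2, v x • MatMulTwo.mul120 ℂ x.2 (Y x.1) := by
  simp [M120Lin, LinearMap.sum_apply]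

/-- `Y` is an ANNIHILATING `10`-FRAME of the tensor `S` (slots `S c a b`): the ten bilinear forms `Y_r` on
`A × B` are orthonormal for the standard Hermitian product of `ℂ^{P2 × P2}` (unit norms stated over `ℝ`,
orthogonality over `ℂ`) and each annihilates every `C`-slice of `S` (`Y_r ∈ annSub S`, the tree's
`t(C*)^⊥`). For `S` of border rank `≤ 6` such frames exist by weak border apolarity (`16 − 6 = 10`). -/
def IsAnnFrame (S : P2 → P2 → P2 → ℂ) (Y : Fin 10 → (P2 × P2 → ℂ)) : Prop :=
  (∀ r, ∑ p, ‖Y r p‖ ^ 2 = 1) ∧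
  (∀ r r', r ≠ r' → ∑ p, conj (Y r p) * Y r' p = 0) ∧
  (∀ r, Y r ∈ annSub S)

/-- THE CERTIFICATE at level `φ₀`: at every annihilating `10`-frame `Y` of `⟨2,2,2⟩` one of the two
multiplication maps has its `35`-th singular value `≥ φ₀`, in Courant–Fischer form — every `6`-dimensional
subspace of the `40`-dimensional domain (`6 = 40 − 35 + 1`) contains a non-zero vector stretched by at
least `φ₀`. For `φ₀ → 0⁺` this says "rank `≥ 35` for one test", the content of the tree's proof of
`7 ≤ R̲(⟨2,2,2⟩)`; the uniform margin is the new, quantitative layer. -/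
def FrameGapCertificate (φ₀ : ℝ) : Prop :=
  0 < φ₀ ∧ ∀ Y : Fin 10 → (P2 × P2 → ℂ), IsAnnFrame (matMulTensor ℂ 2 2 2) Y →
    (∀ V : Submodule ℂ (Fin 10 × P2 → ℂ), Module.finrank ℂ V = 6 →
        ∃ v ∈ V, v ≠ 0 ∧ φ₀ ^ 2 * ∑ x, ‖v x‖ ^ 2 ≤ ∑ y, ‖M210Lin Y v y‖ ^ 2) ∨
    (∀ V : Submodule ℂ (Fin 10 × P2 → ℂ), Module.finrank ℂ V = 6 →
        ∃ v ∈ V, v ≠ 0 ∧ φ₀ ^ 2 * ∑ x, ‖v x‖ ^ 2 ≤ ∑ y, ‖M120Lin Y v y‖ ^ 2)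

/-! ## The stubs -/

/-- **Stub A — weak border apolarity for honest rank `≤ 6`, frame form (the K-input).** Every tensor `S`
of rank `≤ 6` in the `2 × 2` format has an annihilating `10`-frame `Y` whose `(210)` and `(120)`
multiplication maps both have rank `≤ 34` (`= dim S²A* ⊗ B* − 6`).
Why plausibly true: `algBorderRank S ≤ tensorRank S ≤ 6` (`algBorderRank_le_tensorRank`), so
`TensorApolarity.exists_subspace_of_algBorderRank_le S (r := 6) e` (`e : Fin 6 ↪ P2 × P2`; it perturbs an
ARBITRARY, possibly degenerate, decomposition into general position by `IsApproxDecomposition.perturb` +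
`det_pt_perturb_ne_zero` — triage sharpening (1)) gives `F ≤ slicePerp S = annSub S` with
`finrank F ≥ 16 − 6 = 10`, `finrank (prodA F ⊔ altA) ≤ 64 − 6`, `finrank (prodB F ⊔ altB) ≤ 64 − 6`; with
`prodA_inf_altA_eq_bot` (char `0`) and `finrank altA = 24` this is `finrank (F·A*) ≤ 34`, and
`mulA f (Pi.single a₀ 1) = MatMulTwo.mul210Fun a₀ f` entrywise (TensorApolarityForms docstring), so
`F·A* = ⨆ a₀, F.map (mul210 ℂ a₀)`; equivalently run the first half of
`MatMulTwo.seven_le_algBorderRank_matMulTensor_two` (`isApproxDecomposition_pert`,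
`finrank_I21_pert_add_le`, `map_mul210_limSub_le`, `finrank_symA_le`) for a general `S`. Then choose a
`10`-dimensional `F' ≤ F` (monotonicity keeps both bounds), take an orthonormal basis of `F'` for the
standard Hermitian product (Gram–Schmidt in `EuclideanSpace ℂ (P2 × P2)`, transported by `WithLp.equiv`),
and note `LinearMap.range (M210Lin Y) = ⨆ a₀, (span (range Y)).map (mul210 ℂ a₀)` (`M210Lin_apply`).
True also for `S = 0` (`annSub 0 = ⊤`; forms vanishing at six generic points of `A × B` do it).
Size M (all ingredients in tree/Mathlib; the work is the coordinate bookkeeping span/frame/range). -/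
theorem stub_annFrame_of_rank_le_six :
    ∀ S : P2 → P2 → P2 → ℂ, tensorRank S ≤ 6 →
      ∃ Y : Fin 10 → (P2 × P2 → ℂ), IsAnnFrame S Y ∧
        Module.finrank ℂ (LinearMap.range (M210Lin Y)) ≤ 34 ∧
        Module.finrank ℂ (LinearMap.range (M120Lin Y)) ≤ 34 := by
  sorry

/-- **Stub B — the frame-gap certificate (THE LEVER; hardest stub of the line).** Some `φ₀ > 0` is a
uniform singular-value gap: at every annihilating `10`-frame of `⟨2,2,2⟩`, `σ₃₅ ≥ φ₀` for the `(210)` or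
the `(120)` multiplication map (`FrameGapCertificate φ₀`).
Why plausibly true: (qualitative skeleton, PROVED) for ten linearly independent `Y_r ∈ annSub ⟨2,2,2⟩` one
of the product spans has `finrank ≥ 35` — the second half of `MatMulTwo.seven_le_algBorderRank_matMulTensor_two`
(torus degeneration to `≥ 10` of the `12` weight lines `MatMulTwo.wv`, `finrank_le_card_weightLines`,
`map_inPart_le`, then the kernel-checked `MatMulTwo.rank_test_ge`), extracted in frame form as
`frame_fails_a_test` (triage r1-1, Q.lean on the item, rc 0, 0 sorries); rank `≥ 35` is `σ₃₅ > 0`, i.e. the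
Courant–Fischer clause for SOME `φ₀(Y) > 0`; the set of annihilating orthonormal `10`-frames is compact
(closed in a product of spheres) and `Y ↦ max(σ₃₅(M210Lin Y), σ₃₅(M120Lin Y))` is continuous, so a uniform
`φ₀ > 0` exists. INTENDED (effective) proof — the content the route wants: an explicit rational `φ₀`
(numerics of the card: the `66` torus-fixed frames give `1/√6 ≈ 0.408` or `1/√3`, `40` descents end in
`[0.2697, 0.41]`, nothing below `0.26`; kit j007392 / j007500 re-run the landscape and auto-attach), via the
card's reduction to `2`-frames `F = E^⊥ ∩ W_T` and the `8 × 8` integer-linear matrices `C_F = [C(f₁); C(f₂)]`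
(`σ₃₅(M_E) ≥ σ₃(C_F)`), certified either by a symmetry-reduced Putinar/SOS identity for
`Σ|3×3 minors|² ≥ c` on `St(2, ℂ¹²)` checked by `ring_nf`/`norm_num`, or positivity-free by Nullstellensatz
cofactors over `ℚ` for the Plücker coordinates (`linear_combination`). Any rational `φ₀` below the certified
landscape minimum will do (triage sharpening (4)); `φ₀` is deliberately not fixed here.
Why it might fail (as an EFFECTIVE statement only): SOS degree after symmetry reduction unknown; the
Gröbner saturation may not terminate — then the compactness proof still closes the stub. Size XL. -/
theorem stub_frameGapCertificate : ∃ φ₀ : ℝ, FrameGapCertificate φ₀ := by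
  sorry

/-- **Stub C1 — annihilator defect under high fidelity (metric transfer, part 1).** If `S` beats fidelity
`1 − η` against `T = ⟨2,2,2⟩`, i.e. `(1 − η)·8·‖S‖² < |∑ S·T|²`, then every bilinear form `φ` annihilating the
slices of `S` almost annihilates the slices of `T`: `∑_c |∑_{a,b} φ(a,b) T(c,a,b)|² ≤ 8η · ∑ |φ|²`.
Why plausibly true (three lines on paper): the hypothesis forces `S ≠ 0` and `η > 1 − fid ≥ 0`
(Cauchy–Schwarz, `‖T‖² = 8`); put `α := ⟨S,T⟩/‖S‖²` (Hermitian) and `T⊥ := T − αS`, so `‖T⊥‖² = 8(1 − fid) < 8η`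
(Pythagoras); the `ℂ`-linear functionals `ψ_c(X) := ∑_{ab} φ(a,b) X(c,a,b)` kill `S`, hence
`ψ_c(T) = ψ_c(T⊥)` and `∑_c |ψ_c(T⊥)|² ≤ ∑_c ‖φ‖² ‖T⊥(c,·,·)‖² = ‖φ‖² ‖T⊥‖²` (Cauchy–Schwarz slice by slice;
`T` has real `0/1` entries, so `|∑ S·T| = |⟨S,T⟩|`). Vacuous for `η < 0` and for `S = 0`. No rephasing of
`S`, no orthonormalisation. Size S–M (finite sums over `P2 × P2`, `Finset.inner_mul_le_norm_mul_norm` /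
`Complex.abs_sum_le`-type Cauchy–Schwarz, `Complex.normSq` bookkeeping). -/
theorem stub_annihilator_defect :
    ∀ (η : ℝ) (S : P2 → P2 → P2 → ℂ),
      (1 - η) * 8 * (∑ a, ∑ b, ∑ c, ‖S a b c‖ ^ 2) <
          ‖∑ a, ∑ b, ∑ c, S a b c * matMulTensor ℂ 2 2 2 a b c‖ ^ 2 →
      ∀ φ : P2 × P2 → ℂ, φ ∈ annSub S →
        ∑ c, ‖∑ a, ∑ b, φ (a, b) * matMulTensor ℂ 2 2 2 c a b‖ ^ 2 ≤ 8 * η * ∑ p, ‖φ p‖ ^ 2 := by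
  sorry

/-- **Stub C2 — kernel transfer to an annihilating frame of `T` (metric transfer, part 2).** Let `Y` be an
orthonormal `10`-frame of bilinear forms whose total defect against the slices of `T = ⟨2,2,2⟩` is
`∑_r ∑_c |∑_{ab} Y_r(a,b) T(c,a,b)|² ≤ θ ≤ 1/8`, and whose `(210)` and `(120)` multiplication maps have rank
`≤ 34`. Then there is an annihilating `10`-frame `Y'` of `T` and `6`-dimensional subspaces `V₁, V₂` of
`ℂ^{10 × 4}` with `‖M210Lin Y' v‖² ≤ 4θ‖v‖²` on `V₁` and `‖M120Lin Y' v‖² ≤ 4θ‖v‖²` on `V₂`.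
Why plausibly true: `W_T := annSub T` is the Hermitian orthogonal complement of the four slices `T_c`
(real, pairwise orthogonal, `‖T_c‖² = 2`), so with `P` the orthogonal projection onto `W_T`,
`‖Y_r − PY_r‖² = ½ ∑_c |∑ Y_r·T_c|²` and `Z := Y − PY` has `‖Z‖_F² ≤ θ/2`. Hence `c ↦ ∑ c_r PY_r` has
`σ_min ≥ 1 − √(θ/2) ≥ 3/4`, `E' := span{PY_r} ≤ W_T` is `10`-dimensional; let `Y'` be an orthonormal basis of
`E'` (`IsAnnFrame T Y'`) and `PY_r = ∑_{r'} R(r,r') Y'_{r'}` (`σ_min(R) ≥ 3/4`). For `v ∈ ker (M210Lin Y)`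
(dimension `≥ 40 − 34 = 6`; take a `6`-dimensional part `V₀`) put `(Φv)(r',a) := ∑_r R(r,r') v(r,a)`:
`Φ` is injective, `V₁ := Φ(V₀)` has dimension `6`, `‖Φv‖ ≥ ¾‖v‖`, and by linearity of `mul210`
`M210Lin Y' (Φv) = M210Lin (PY) v = −M210Lin Z v`, while `(M210Lin Z v)(a,a',b) = U(a',(a,b)) + U(a,(a',b))`
with `U := vᵀZ`, `‖U‖_F ≤ ‖Z‖_F ‖v‖`, so `‖M210Lin Y' (Φv)‖² ≤ 4‖Z‖_F²‖v‖² ≤ 2θ · (16/9) ‖Φv‖² ≤ 4θ‖Φv‖²`.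
Same for `(120)`. Pure finite-dimensional linear algebra (no singular value decomposition needed: only an
orthonormal basis of a subspace, `LinearMap.finrank_range_add_finrank_ker`, `Submodule.finrank_map_*` for an
injective map, triangle and Cauchy–Schwarz inequalities in coordinates). Size M–L. -/
theorem stub_kernel_transfer :
    ∀ (θ : ℝ) (Y : Fin 10 → (P2 × P2 → ℂ)),
      (∀ r, ∑ p, ‖Y r p‖ ^ 2 = 1) →
      (∀ r r', r ≠ r' → ∑ p, conj (Y r p) * Y r' p = 0) →
      ∑ r, ∑ c, ‖∑ a, ∑ b, Y r (a, b) * matMulTensor ℂ 2 2 2 c a b‖ ^ 2 ≤ θ →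
      θ ≤ 1 / 8 →
      Module.finrank ℂ (LinearMap.range (M210Lin Y)) ≤ 34 →
      Module.finrank ℂ (LinearMap.range (M120Lin Y)) ≤ 34 →
      ∃ Y' : Fin 10 → (P2 × P2 → ℂ), IsAnnFrame (matMulTensor ℂ 2 2 2) Y' ∧
        (∃ V : Submodule ℂ (Fin 10 × P2 → ℂ), Module.finrank ℂ V = 6 ∧
            ∀ v ∈ V, ∑ y, ‖M210Lin Y' v y‖ ^ 2 ≤ 4 * θ * ∑ x, ‖v x‖ ^ 2) ∧
        (∃ V : Submodule ℂ (Fin 10 × P2 → ℂ), Module.finrank ℂ V = 6 ∧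
            ∀ v ∈ V, ∑ y, ‖M120Lin Y' v y‖ ^ 2 ≤ 4 * θ * ∑ x, ‖v x‖ ^ 2) := by
  sorry

/-! ## The composition (kernel-checked, no `sorry` of its own) -/

/-- A non-zero coordinate vector has positive square norm. -/
theorem sum_norm_sq_pos {ι : Type} [Fintype ι] {v : ι → ℂ} (hv : v ≠ 0) :
    0 < ∑ x, ‖v x‖ ^ 2 := by
  obtain ⟨x, hx⟩ : ∃ x, v x ≠ 0 := by
    by_contra h
    push Not at h
    exact hv (funext h)
  exact lt_of_lt_of_le (pow_pos (norm_pos_iff.mpr hx) 2)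
    (Finset.single_le_sum (f := fun x => ‖v x‖ ^ 2) (fun y _ => by positivity) (Finset.mem_univ x))

/-- **`FidelityGapTwoSix` from the four stubs**, with `ε := min (1/640) (φ₀²/640)` for the certified `φ₀`:
a rank-`≤ 6` tensor `S` violating the gap has an annihilating `10`-frame `Y` with both multiplication ranks
`≤ 34` (stub A); each row is `8ε`-defective against the slices of `T` (stub C1), total defect
`θ = 80ε ≤ 1/8`; stub C2 moves it to an annihilating frame `Y'` of `T` carrying `6`-planes `V₁, V₂` of
`320ε`-small vectors for the two maps; the certificate at `Y'` finds `v ≠ 0` in the relevant plane with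
`φ₀²‖v‖² ≤ ‖M v‖² ≤ 320ε‖v‖² ≤ φ₀²‖v‖²/2`, absurd. -/
theorem FidelityGapTwoSix_of : FidelityGapTwoSix := by
  obtain ⟨φ₀, hφ₀, hcert⟩ := stub_frameGapCertificate
  refine ⟨min (1 / 640) (φ₀ ^ 2 / 640), lt_min (by norm_num) (by positivity), fun S hS => ?_⟩
  set ε : ℝ := min (1 / 640) (φ₀ ^ 2 / 640) with hε_def
  have hε1 : ε ≤ 1 / 640 := min_le_left _ _
  have hε2 : ε ≤ φ₀ ^ 2 / 640 := min_le_right _ _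
  by_contra hlt
  rw [not_le] at hlt
  -- stub A: an annihilating 10-frame of `S` passing both rank tests
  obtain ⟨Y, hY, h210, h120⟩ := stub_annFrame_of_rank_le_six S hS
  obtain ⟨hYnorm, hYorth, hYann⟩ := hY
  -- stub C1, row by row: total defect `≤ 80 ε`
  have hrow : ∀ r : Fin 10,
      ∑ c, ‖∑ a, ∑ b, Y r (a, b) * matMulTensor ℂ 2 2 2 c a b‖ ^ 2 ≤ 8 * ε := by
    intro r
    have h := stub_annihilator_defect ε S hlt (Y r) (hYann r)
    rw [hYnorm r, mul_one] at h
    exact h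
  have hdef : ∑ r, ∑ c, ‖∑ a, ∑ b, Y r (a, b) * matMulTensor ℂ 2 2 2 c a b‖ ^ 2 ≤ 80 * ε := by
    calc ∑ r, ∑ c, ‖∑ a, ∑ b, Y r (a, b) * matMulTensor ℂ 2 2 2 c a b‖ ^ 2
        ≤ ∑ r : Fin 10, 8 * ε := Finset.sum_le_sum fun r _ => hrow r
      _ = 80 * ε := by
          rw [Finset.sum_const, Finset.card_univ, Fintype.card_fin]
          simp only [nsmul_eq_mul, Nat.cast_ofNat]
          ring
  have hθ : 80 * ε ≤ 1 / 8 := by linarith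
  -- stub C2: an annihilating frame of `T` with small vectors on 6-planes
  obtain ⟨Y', hY', ⟨V₁, hV₁, hM₁⟩, ⟨V₂, hV₂, hM₂⟩⟩ :=
    stub_kernel_transfer (80 * ε) Y hYnorm hYorth hdef hθ h210 h120
  -- the certificate at `Y'`
  have hφsq : 0 < φ₀ ^ 2 := pow_pos hφ₀ 2
  rcases hcert Y' hY' with h | h
  · obtain ⟨v, hv, hv0, hle⟩ := h V₁ hV₁
    have hpos : 0 < ∑ x, ‖v x‖ ^ 2 := sum_norm_sq_pos hv0
    have h1 : φ₀ ^ 2 * ∑ x, ‖v x‖ ^ 2 ≤ 4 * (80 * ε) * ∑ x, ‖v x‖ ^ 2 := hle.trans (hM₁ v hv)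
    have h2 : ε * ∑ x, ‖v x‖ ^ 2 ≤ φ₀ ^ 2 / 640 * ∑ x, ‖v x‖ ^ 2 :=
      mul_le_mul_of_nonneg_right hε2 hpos.le
    have h3 : 0 < φ₀ ^ 2 * ∑ x, ‖v x‖ ^ 2 := mul_pos hφsq hpos
    nlinarith
  · obtain ⟨v, hv, hv0, hle⟩ := h V₂ hV₂
    have hpos : 0 < ∑ x, ‖v x‖ ^ 2 := sum_norm_sq_pos hv0
    have h1 : φ₀ ^ 2 * ∑ x, ‖v x‖ ^ 2 ≤ 4 * (80 * ε) * ∑ x, ‖v x‖ ^ 2 := hle.trans (hM₂ v hv)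
    have h2 : ε * ∑ x, ‖v x‖ ^ 2 ≤ φ₀ ^ 2 / 640 * ∑ x, ‖v x‖ ^ 2 :=
      mul_le_mul_of_nonneg_right hε2 hpos.le
    have h3 : 0 < φ₀ ^ 2 * ∑ x, ‖v x‖ ^ 2 := mul_pos hφsq hpos
    nlinarith

end Summit.MatrixMultiplication.MatrixMultiplication.Cruxes.FidelityGapTwoSix.QuantitativeApolarity

end
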